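import Mathlib
import Summits.MatrixMultiplication.MatrixMultiplication.Theses.FidelityWitnesses

/-!
# Sketch — first lemmas of the crux-ideate cards for `FidelityThesis` (stmt-MatrixMultiplication-4956), ideator 3, round 1

Signatures only (proofs `sorry`); every constant is an existing declaration:
`Literature.Computability.AlgebraicComplexity.{tensorRank, matMulTensor, algBorderRank}`,
`Summit.MatrixMultiplication.MatrixMultiplication.Theses.FidelityWitnesses.FidelityThesis`.

* Card A `border-rank-doubling`: `BorderRankDoubling`, `DoublingDefect`, `gap_doubling_same_budget`,
  `superquadratic_of_doubling`, `fidelityThesis_of_superquadratic`, `fidelityThesis_of_doublingDefect`,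
  `fidelityThesis_iff_powersOfTwo`.
* Card B `invariant-trace-identities`: `sandwich`, `sandwich_matMulTensor`, `evalAt`, `triadSum`,
  `vanishes_on_rank_le_iff_bind_eq_zero`, `invariant_equation_completeness`,
  `notMem_closure_of_invariant_equation`.
-/

namespace Summit.MatrixMultiplication.MatrixMultiplication.Cruxes.FidelityThesis.Sketch

open scoped BigOperators
open Literature.Computability.AlgebraicComplexity

noncomputable section

/-- cubic matrix-multiplication format index `(row, col)`. -/
abbrev Idx (n : ℕ) := Fin n × Fin n

/-- border rank of `⟨n,n,n⟩` over `ℂ` (the tree's algebraic border rank). -/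
def bR (n : ℕ) : ℕ := algBorderRank (matMulTensor ℂ n n n)

/-- captured-fraction bound `θ` at `(n, r)`: every rank-`≤ r` tensor has fidelity `≤ θ` with `⟨n,n,n⟩`
(the route's inequality with `θ = 1 − ε`). -/
def FracLE (n r : ℕ) (θ : ℝ) : Prop :=
  ∀ S : Idx n → Idx n → Idx n → ℂ, tensorRank S ≤ r →
    ‖∑ a, ∑ b, ∑ c, S a b c * matMulTensor ℂ n n n a b c‖ ^ 2 ≤
      θ * (n : ℝ) ^ 3 * ∑ a, ∑ b, ∑ c, ‖S a b c‖ ^ 2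

/-! ### Card A — border-rank doubling / one renormalisation step `⟨2n⟩ = ⟨2,2,2⟩ ⊠ ⟨n⟩` -/

/-- **C⁺ (border-rank form).** Doubling inequality with ratio `ρ`: `bR(⟨2n,2n,2n⟩) > ρ·(bR(⟨n,n,n⟩) − 1)`. -/
def BorderRankDoubling (ρ : ℝ) : Prop :=
  ∀ n : ℕ, 1 ≤ n → ρ * ((bR n : ℝ) - 1) < (bR (2 * n) : ℝ)

/-- superquadratic border rank of `⟨n,n,n⟩`, uniformly in `n`. -/
def SuperquadraticBorderRank : Prop :=
  ∃ δ : ℝ, 0 < δ ∧ ∃ c : ℝ, 0 < c ∧ ∀ n : ℕ, 1 ≤ n → c * (n : ℝ) ^ (2 + δ) < (bR n : ℝ)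

/-- monotonicity of `bR(⟨n,n,n⟩)` in `n` (restriction `⟨m⟩ ≥ ⟨n⟩`, tree `TensorRestrictsTo.algBorderRank_le`). -/
def BorderRankMonotone : Prop := ∀ n m : ℕ, n ≤ m → bR n ≤ bR m

/-- A2: a doubling ratio `ρ > 4` forces superquadratic border rank, exponent `log₂ ρ` (real arithmetic
along `n = 2^k`, seed `bR 2 = 7` (tree: `Landsberg2005`/`BorderRankMatMulTwoHolds`), fill-in by monotonicity). -/
theorem superquadratic_of_doubling {ρ : ℝ} (hρ : 4 < ρ) (hD : BorderRankDoubling ρ)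
    (hmono : BorderRankMonotone) (h2 : bR 2 = 7) : SuperquadraticBorderRank := by
  sorry

/-- A3: superquadratic border rank ⟹ the crux (completeness direction, PROVED in the tree:
`witnessCompleteness_proof` (stmt-4962) + Alder–Strassen `alder_secantVariety_eq_setOf_algBorderRank_le_holds`). -/
theorem fidelityThesis_of_superquadratic (h : SuperquadraticBorderRank) :
    _root_.Summit.MatrixMultiplication.MatrixMultiplication.Theses.FidelityWitnesses.FidelityThesis := by
  sorry

/-- A1 (provable now; the TRIVIAL half of the renormalisation step): a captured-fraction bound at `(n, r)`
persists at `(2n, r)` with the same `θ` — restrict a rank-`≤ r` tensor of format `2n` to the 8 support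
blocks of `⟨2,2,2⟩ ⊠ ⟨n,n,n⟩` (rank-one block functionals keep rank `≤ r`) and Cauchy–Schwarz; equivalently
the exact second-moment identity `E_c ‖S(c) − c(⟨2,2,2⟩)·T_n‖² = ‖S − T_{2n}‖²/64` over random
rank-one block functionals `c`. -/
theorem gap_doubling_same_budget (n r : ℕ) (θ : ℝ) (hθ : 0 ≤ θ) (h : FracLE n r θ) :
    FracLE (2 * n) r θ := by
  sorry

/-- **C⁺ (fidelity form, the inductive step with a gain).** `DoublingDefect ρ η`: multiplying the rank
budget by `ρ` while doubling `n` still loses the factor `(1 − η/8)` of captured fraction, as long as there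
is a gap (`θ < 1`). -/
def DoublingDefect (ρ η : ℝ) : Prop :=
  ∀ n r r' : ℕ, ∀ θ : ℝ, 1 ≤ n → 0 ≤ θ → θ < 1 → (r' : ℝ) ≤ ρ * r →
    FracLE n r θ → FracLE (2 * n) r' ((1 - η / 8) * θ)

/-- A4: the inductive step with `ρ > 4`, `η > 0`, seeded by the PROVED rung `FidelityGapTwoSix`
(stmt-4957: some `ε > 0` at `(2,6)`), gives the crux with `δ = log₂ ρ − 2`, `c = 6/ρ²`
(budget `6ρ^k` at `n = 2^{k+1}`; other `n` by A1-type restriction). -/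
theorem fidelityThesis_of_doublingDefect {ρ η : ℝ} (hρ : 4 < ρ) (hη : 0 < η)
    (hstep : DoublingDefect ρ η)
    (hseed : _root_.Summit.MatrixMultiplication.MatrixMultiplication.Theses.FidelityWitnesses.FidelityGapTwoSix) :
    _root_.Summit.MatrixMultiplication.MatrixMultiplication.Theses.FidelityWitnesses.FidelityThesis := by
  sorry

/-- A5 (Fekete form of the crux; uniformity in `n` is free along powers of two): the crux holds iff some
`η > 0` has `(4+η)^k < bR(⟨2^k,2^k,2^k⟩)` for EVERY `k ≥ 1` (⇒: superquadratic + `bR(⟨n⟩) > n²` for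
`n ≥ 2`; ⇐: monotone fill-in + completeness). -/
theorem fidelityThesis_iff_powersOfTwo (hmono : BorderRankMonotone) :
    _root_.Summit.MatrixMultiplication.MatrixMultiplication.Theses.FidelityWitnesses.FidelityThesis ↔
      ∃ η : ℝ, 0 < η ∧ ∀ k : ℕ, 1 ≤ k → (4 + η) ^ k < (bR (2 ^ k) : ℝ) := by
  sorry

/-! ### Card B — invariant equations = triangle-quiver trace identities -/

/-- The sandwich action of `(P,Q,R) ∈ GL_n³` on cubic-format tensors, normalised to FIX `⟨n,n,n⟩`:
with `matMulTensor`'s index convention (`a = (i,k)` output, `b = (i,j)`, `c = (j,k)`) leg `a` moves by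
`P ⊗ R⁻ᵀ`, leg `b` by `P⁻ᵀ ⊗ Q`, leg `c` by `Q⁻ᵀ ⊗ R`. -/
def sandwich {n : ℕ} (P Q R : Matrix.GeneralLinearGroup (Fin n) ℂ)
    (S : Idx n → Idx n → Idx n → ℂ) : Idx n → Idx n → Idx n → ℂ :=
  fun a b c => ∑ a' : Idx n, ∑ b' : Idx n, ∑ c' : Idx n,
    (P : Matrix (Fin n) (Fin n) ℂ) a.1 a'.1 *
    ((P⁻¹ : Matrix.GeneralLinearGroup (Fin n) ℂ) : Matrix (Fin n) (Fin n) ℂ) b'.1 b.1 *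
    (Q : Matrix (Fin n) (Fin n) ℂ) b.2 b'.2 *
    ((Q⁻¹ : Matrix.GeneralLinearGroup (Fin n) ℂ) : Matrix (Fin n) (Fin n) ℂ) c'.1 c.1 *
    (R : Matrix (Fin n) (Fin n) ℂ) c.2 c'.2 *
    ((R⁻¹ : Matrix.GeneralLinearGroup (Fin n) ℂ) : Matrix (Fin n) (Fin n) ℂ) a'.2 a.2 *
    S a' b' c'

/-- B0 (provable now): `⟨n,n,n⟩` is fixed by the whole sandwich group (its stabiliser `G_T ≅ GL_n³`). -/
theorem sandwich_matMulTensor {n : ℕ} (P Q R : Matrix.GeneralLinearGroup (Fin n) ℂ) :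
    sandwich P Q R (matMulTensor ℂ n n n) = matMulTensor ℂ n n n := by
  sorry

/-- B0' (provable now): the sandwich action preserves rank `≤ r` (it is a change of bases in each leg). -/
theorem tensorRank_sandwich_le {n : ℕ} (P Q R : Matrix.GeneralLinearGroup (Fin n) ℂ)
    (S : Idx n → Idx n → Idx n → ℂ) : tensorRank (sandwich P Q R S) ≤ tensorRank S := by
  sorry

/-- evaluation of a polynomial in the `n⁶` tensor coordinates at a tensor. -/
def evalAt {n : ℕ} (F : MvPolynomial (Idx n × Idx n × Idx n) ℂ) (S : Idx n → Idx n → Idx n → ℂ) : ℂ :=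
  MvPolynomial.eval (fun i => S i.1 i.2.1 i.2.2) F

/-- the symmetric `r`-triad substitution `S = Σ_{l<r} u_l ⊗ v_l ⊗ w_l`, coordinates as polynomials in the
`3·r·n²` triad entries (variable `(l, 0, ·) = u_l`, `(l, 1, ·) = v_l`, `(l, 2, ·) = w_l`). -/
def triadSum (n r : ℕ) : (Idx n × Idx n × Idx n) → MvPolynomial (Fin r × Fin 3 × Idx n) ℂ :=
  fun i => ∑ l : Fin r,
    MvPolynomial.X (l, (0 : Fin 3), i.1) * MvPolynomial.X (l, (1 : Fin 3), i.2.1) *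
      MvPolynomial.X (l, (2 : Fin 3), i.2.2)

/-- B1 (provable now, `MvPolynomial.funext` over the infinite field `ℂ`): `F` vanishes on all tensors of
rank `≤ r` iff the substituted polynomial `F ∘ Σ_r` is ZERO — i.e. iff `F ∘ Σ_r`, read as a formal
trace expression in `3r` arrow variables of the triangle quiver, is a (trace) IDENTITY of `M_n`. -/
theorem vanishes_on_rank_le_iff_bind_eq_zero {n r : ℕ} (F : MvPolynomial (Idx n × Idx n × Idx n) ℂ) :
    (∀ S : Idx n → Idx n → Idx n → ℂ, tensorRank S ≤ r → evalAt F S = 0) ↔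
      MvPolynomial.bind₁ (triadSum n r) F = 0 := by
  sorry

/-- **B2 (Reynolds completeness; provable now via the Reynolds operator of the reductive `G_T`, or Haar
averaging over `U(n)³`).** If `⟨n,n,n⟩` is not a limit of rank-`≤ r` tensors then some `G_T`-INVARIANT
polynomial — a polynomial in closed trace words of the triangle quiver — vanishes on every rank-`≤ r`
tensor and not at `⟨n,n,n⟩`. With B1: `bR(⟨n,n,n⟩) > r` iff some formal cyclic-contraction polynomial
becomes a trace identity of `M_n` under the symmetric `r`-triad substitution while its pair-groupoid
count at `⟨n,n,n⟩` is non-zero. -/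
theorem invariant_equation_completeness (n r : ℕ)
    (h : matMulTensor ℂ n n n ∉ closure {S : Idx n → Idx n → Idx n → ℂ | tensorRank S ≤ r}) :
    ∃ F : MvPolynomial (Idx n × Idx n × Idx n) ℂ,
      (∀ S : Idx n → Idx n → Idx n → ℂ, tensorRank S ≤ r → evalAt F S = 0) ∧
      evalAt F (matMulTensor ℂ n n n) ≠ 0 ∧
      (∀ (P Q R : Matrix.GeneralLinearGroup (Fin n) ℂ) (S : Idx n → Idx n → Idx n → ℂ),
        evalAt F (sandwich P Q R S) = evalAt F S) := by
  sorry

/-- B3 (soundness, provable now by continuity of polynomial maps): such an `F` certifies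
`⟨n,n,n⟩ ∉ closure{rank ≤ r}`, i.e. `bR(⟨n,n,n⟩) > r` (Alder–Strassen), i.e. a fidelity gap at `(n,r)`. -/
theorem notMem_closure_of_invariant_equation (n r : ℕ) (F : MvPolynomial (Idx n × Idx n × Idx n) ℂ)
    (hF : ∀ S : Idx n → Idx n → Idx n → ℂ, tensorRank S ≤ r → evalAt F S = 0)
    (hT : evalAt F (matMulTensor ℂ n n n) ≠ 0) :
    matMulTensor ℂ n n n ∉ closure {S : Idx n → Idx n → Idx n → ℂ | tensorRank S ≤ r} := by
  sorry

end

end Summit.MatrixMultiplication.MatrixMultiplication.Cruxes.FidelityThesis.Sketch
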